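import Summits.BirchSwinnertonDyer.BirchSwinnertonDyer.Theorems.SignedLowerHalvesKobayashiLowerHalfLargeImagePairedDescent
import Literature.NumberTheory.EllipticCurves.PlusMinusPAdicLFunctionProofs
import HarnessLib

/-!
# Route `SignedLowerHalves`, crux 3 `KobayashiLowerHalfLargeImage` (item stmt-BirchSwinnertonDyer-19001):
# the DOOR stub of the unregistered line `cyclic_semistabilisation` (`stub_pairedDoor`) on the named published
# inputs — body VERBATIM, predicates unfolded (cell `bsd-ssimc`, seat `bsd-line-slh-p1` LEAD gen 12; helper
# file `--supports 19001`; L0 on the new line `Lines/cyclic_semistabilisation.lean`, cruxidea k2 g13)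

HONEST FRAMING: the crux is OPEN; the line `cyclic_semistabilisation` is NOT registered (W-79; line of record
`kurihara_rigidity`), and its load-bearing stub `stub_semistableHilbertEisenstein` (a signed Eisenstein lower
bound over a real quadratic field at a non-ordinary prime) is open in print. This file closes only the line's
size-S DOOR stub, exactly as `Theorems.CartanChamber.pairedDoorCartanStatement_of_facts` (p633438) did for the
line `cartan_chamber`: so that, IF a future lead registers the line, `stub_pairedDoor` is a tree theorem modulo
the named published facts the landed door `X7.kobayashiLowerDivisibility_of_paired_twist` consumes. BSD is
not proved by any of this; nothing about any curve is asserted.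

## What this file does

* `not_dvd_two_mul_of_not_dvd` — `p` an odd prime, `p ∤ d` ⇒ `p ∤ 2d` (the line's proved anchor
  `not_dvd_two_mul_of_isSemistabilisingDiscriminant`, restated on the unfolded hypotheses).
* `pairedDoorStatement_of_facts` — **the body of the line's `PairedDoorStatement` VERBATIM** (its predicate
  `IsSemistabilisingDiscriminant W p dF` unfolded to its six conjuncts, `IsAdditivePrime` unfolded): for an X7
  pair at `p ≥ 5` with `a_p = 0` and `ρ̄` onto, a semistabilising discriminant `d_F` and a globally minimal
  model `W'` of `W^{(d_F)}`, `PairedKobayashiLowerDivisibility W W' p ε → KobayashiLowerDivisibility W p ε`,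
  GRANTED Kobayashi Thm. 1.2 (`h12`) / Thm. 4.1 (`h41`), modularity (`hmod`), the period-unit facts
  (`h5`, `h3`) and Wuthrich Lemma 20 (`hL20`); Pollack's theorem is a tree THEOREM
  (`pollack_exists_plusMinusPAdicLFunction_holds`) and is discharged here. Of the discriminant hypothesis
  only `Squarefree d_F` and `p ∤ d_F` are used.

References: [Kobayashi2003] Thm. 1.2, Thm. 4.1, Conjecture (p. 2); [Pollack2003] Prop. 6.18; [Wuthrich2014]
Lemma 20. Crux dir: `Lines/cyclic-semistabilisation.md`, `Lines/cyclic_semistabilisation.lean` (k2 g13).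
-/

set_option autoImplicit false
set_option linter.dupNamespace false

noncomputable section

open scoped Classical MatrixGroups ModularForm

open CongruenceSubgroup WeierstrassCurve Literature.NumberTheory.EllipticCurves
  Literature.NumberTheory.EllipticCurves.ModularForms
  Literature.NumberTheory.EllipticCurves.Rank1Residual Literature.NumberTheory.EllipticCurves.Kobayashi2003
  Literature.NumberTheory.EllipticCurves.Rank1Residual.Typed
  Summit.BirchSwinnertonDyer.Rank1Residual.Supersingular

namespace Summit.BirchSwinnertonDyer.BirchSwinnertonDyer.Theorems.CyclicSemistabilisation

/-- An odd prime not dividing `d` does not divide `2d`. [folklore] -/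
theorem not_dvd_two_mul_of_not_dvd {p : ℕ} (hp : p.Prime) (hp2 : p ≠ 2) {d : ℤ} (hd : ¬ (p : ℤ) ∣ d) :
    ¬ (p : ℤ) ∣ 2 * d := by
  intro h
  have hpZ : Prime (p : ℤ) := Nat.prime_iff_prime_int.mp hp
  rcases hpZ.dvd_or_dvd h with h2 | h2
  · have hle := Int.le_of_dvd (by norm_num) h2
    have h2' : p ≤ 2 := by exact_mod_cast hle
    exact hp2 (le_antisymm h2' hp.two_le)
  · exact hd h2

/-- **`stub_pairedDoor` of line `cyclic_semistabilisation`, on the NAMED published inputs** — the body of the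
line's `PairedDoorStatement` VERBATIM with `IsSemistabilisingDiscriminant W p dF` unfolded
(`0 < d_F ∧ Squarefree d_F ∧ d_F ≡ 1 (4) ∧ p ∤ d_F ∧ d_F square mod p ∧ every additive prime divides d_F`,
"additive" = neither good nor multiplicative): for an X7 pair at `p ≥ 5` with `a_p = 0` and `ρ̄_{E,p}` onto,
any such `d_F` and any globally minimal model `W'` of the twist `W^{(d_F)}`, the PAIRED signed lower
divisibility for `(E, E^{(d_F)})` gives `KobayashiLowerDivisibility W p ε` — ONE application of the landed
door `X7.kobayashiLowerDivisibility_of_paired_twist` (Kobayashi Thm. 1.2 / 4.1 at the twist, modularity, the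
period unit, Wuthrich Lemma 20 by name; Pollack's theorem discharged by
`pollack_exists_plusMinusPAdicLFunction_holds`; `p ∤ 2 d_F` from `p ∤ d_F`, `p` odd). Only the conjuncts
`Squarefree d_F` and `p ∤ d_F` of the discriminant hypothesis are used. CONDITIONAL on the displayed facts.
[cite: Kobayashi2003, Thm. 1.2 (p. 2), Thm. 4.1 (p. 8) and Conjecture (p. 2)] [cite: Pollack2003, Prop. 6.18]
[cite: Wuthrich2014, Lemma 20 (p. 399)] -/
theorem pairedDoorStatement_of_facts
    (h12 : Kobayashi2003.thm12_signedSelmerDual_finite_torsion)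
    (h41 : Kobayashi2003.thm41_signedCharIdeal_divisibility)
    (hmod : nonempty_modularParametrizationData)
    (h5 : realPeriodRat_eq_unit_mul_plusPeriod) (h3 : realPeriodRat_eq_unit_mul_plusPeriod_three)
    (hL20 : Wuthrich2014.lemma20_surjective_threeAdic_of_semistable) :
    ∀ (W : WeierstrassCurve ℚ) [W.IsElliptic] [W.IsGloballyMinimal] (p : ℕ) [Fact p.Prime],
      5 ≤ p → ClassX7 W p → W.frobeniusTrace p = 0 → Surj W p →
      ∀ (dF : ℤ), (0 < dF ∧ Squarefree dF ∧ dF % 4 = 1 ∧ ¬ (p : ℤ) ∣ dF ∧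
          IsSquare ((dF : ℤ) : ZMod p) ∧
          ∀ (q : ℕ) [Fact q.Prime],
            (¬ W.HasGoodReductionAtPrime q ∧ ¬ W.HasMultiplicativeReductionAtPrime q) → (q : ℤ) ∣ dF) →
      ∀ (W' : WeierstrassCurve ℚ) [W'.IsElliptic] [W'.IsGloballyMinimal] (C : VariableChange ℚ),
        C • W' = W.quadraticTwist (dF : ℚ) →
      ∀ ε : ℤˣ, PairedKobayashiLowerDivisibility W W' p ε → KobayashiLowerDivisibility W p ε := by
  intro W _ _ p _ hp5 hX hap hs dF hd W' _ _ C hC ε hpair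
  have hp : p.Prime := Fact.out
  have hp2 : p ≠ 2 := by
    rintro rfl
    omega
  exact X7.kobayashiLowerDivisibility_of_paired_twist W W' p h12 h41
    (fun {_} _ {_} ↦ pollack_exists_plusMinusPAdicLFunction_holds) hmod h5 h3 hL20 hp2 hX hap hs hd.2.1
    (not_dvd_two_mul_of_not_dvd hp hp2 hd.2.2.2.1) hC hpair

end Summit.BirchSwinnertonDyer.BirchSwinnertonDyer.Theorems.CyclicSemistabilisation

end
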